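import Literature.AlgebraicGeometry.Smoothening.KaehlerFibre
import Mathlib.RingTheory.Localization.Ideal
import Mathlib.RingTheory.Localization.AtPrime.Basic
import Mathlib.RingTheory.Smooth.Locus
import HarnessLib

/-!
# The conormal criterion at a prime: `J_𝔮 = 0`

Topic: `Literature/AlgebraicGeometry/Smoothening`; the localized form of the openness criterion
of `ConormalSplitting` / `ConormalBaseChange` (Görtz–Wedhorn II, Thm. 18.74 (iii)⇒(i) in the
étale case, with Prop. 18.76: a closed immersion `X = Spec S/J ↪ Z = Spec S` of schemes smooth
over the base at a point `x`, inducing an injection on the fibres of the differentials at `x`,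
is an open immersion near `x`). Here `S` is formally smooth over `R` (globally), `𝔮 ⊇ J` is a
prime of `S` at which `S/J` is smooth over `R` (`Algebra.IsSmoothAt R (𝔮/J)`), and `L` is a
field with an `S/J`-algebra structure whose kernel on `S` is `𝔮` (a field-valued point of `X`
supported at `x = 𝔮`). If `L ⊗_S Ω[S⁄R] → L ⊗_S Ω[(S/J)⁄R]` is injective, then `J S_𝔮 = 0`
(`map_eq_bot_of_isSmoothAt_of_injective`) — i.e. `X` and `Z` agree near `x`.

The proof localizes everything at `𝔮` and applies `eq_bot_of_formallySmooth_of_injective_map`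
to the local ring `S_𝔮` and the ideal `J S_𝔮`: `S_𝔮` is formally smooth over `R`;
`S_𝔮/J S_𝔮` is the localization of `S/J` at `𝔮/J` (Mathlib: localization commutes with
quotients), hence formally smooth; `L` is an `S_𝔮/JS_𝔮`-algebra through a local homomorphism;
and the fibres of the differentials do not change under localization
(`tensorKaehlerEquivOfIsLocalization`, `tensorQuotientEquiv`).

No named facts are introduced (D-0026).

## References

* U. Görtz, T. Wedhorn, *Algebraic Geometry II*, Springer Spektrum 2023, Thm. 18.74,
  Prop. 18.76 (PDF pp. 106–107). [GortzWedhorn2023]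
-/

noncomputable section

open scoped TensorProduct
open Algebra KaehlerDifferential IsLocalRing

namespace Literature.AlgebraicGeometry.Smoothening

universe u

section QuotientLocalization

variable {S : Type u} [CommRing S] (J : Ideal S) (𝔮 : Ideal S) [𝔮.IsPrime]

/-- For `J ⊆ 𝔮`, the ideal `𝔮/J` of `S/J` is prime. [folklore] -/
theorem isPrime_map_mk (hJ𝔮 : J ≤ 𝔮) : (𝔮.map (Ideal.Quotient.mk J)).IsPrime :=
  Ideal.map_isPrime_of_surjective Ideal.Quotient.mk_surjective (by rwa [Ideal.mk_ker])

variable [h𝔮J : (𝔮.map (Ideal.Quotient.mk J)).IsPrime]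

/-- The image in `S/J` of the complement of a prime `𝔮 ⊇ J` is the complement of `𝔮/J`. [folklore] -/
theorem algebraMapSubmonoid_primeCompl_eq (hJ𝔮 : J ≤ 𝔮) :
    Algebra.algebraMapSubmonoid (S ⧸ J) 𝔮.primeCompl =
      (𝔮.map (Ideal.Quotient.mk J)).primeCompl := by
  ext x
  rw [Algebra.algebraMapSubmonoid, Submonoid.mem_map]
  constructor
  · rintro ⟨s, hs, rfl⟩ hx
    apply hs
    have hx' : s ∈ (𝔮.map (Ideal.Quotient.mk J)).comap (Ideal.Quotient.mk J) := hx
    rw [Ideal.comap_map_of_surjective _ Ideal.Quotient.mk_surjective, ← RingHom.ker_eq_comap_bot,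
      Ideal.mk_ker, sup_eq_left.mpr hJ𝔮] at hx'
    exact hx'
  · intro hx
    obtain ⟨s, rfl⟩ := Ideal.Quotient.mk_surjective x
    exact ⟨s, fun hs => hx (Ideal.mem_map_of_mem _ hs), rfl⟩

/-- **Localization commutes with quotients, at a prime**: `S_𝔮 / J S_𝔮` is the localization of
`S/J` at the prime `𝔮/J` (`J ⊆ 𝔮`). [folklore] -/
theorem isLocalization_atPrime_quotient (hJ𝔮 : J ≤ 𝔮) :
    IsLocalization.AtPrime
      (Localization.AtPrime 𝔮 ⧸ J.map (algebraMap S (Localization.AtPrime 𝔮)))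
      (𝔮.map (Ideal.Quotient.mk J)) := by
  have h := (inferInstance : IsLocalization (Algebra.algebraMapSubmonoid (S ⧸ J) 𝔮.primeCompl)
    (Localization.AtPrime 𝔮 ⧸ J.map (algebraMap S (Localization.AtPrime 𝔮))))
  rw [algebraMapSubmonoid_primeCompl_eq J 𝔮 hJ𝔮] at h
  exact h

omit h𝔮J in
/-- `R → S/J → S_𝔮/JS_𝔮` is a scalar tower. [folklore] -/
theorem isScalarTower_quotient_localization (R : Type u) [CommRing R] [Algebra R S] :
    IsScalarTower R (S ⧸ J)
      (Localization.AtPrime 𝔮 ⧸ J.map (algebraMap S (Localization.AtPrime 𝔮))) :=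
  IsScalarTower.of_algebraMap_eq fun _ => rfl

/-- `(S/J)_{𝔮/J} ≅ S_𝔮/JS_𝔮` over `R`. [folklore] -/
def localizationQuotientEquiv (R : Type u) [CommRing R] [Algebra R S] (hJ𝔮 : J ≤ 𝔮) :
    Localization.AtPrime (𝔮.map (Ideal.Quotient.mk J)) ≃ₐ[R]
      (Localization.AtPrime 𝔮 ⧸ J.map (algebraMap S (Localization.AtPrime 𝔮))) :=
  haveI := isLocalization_atPrime_quotient J 𝔮 hJ𝔮
  haveI := isScalarTower_quotient_localization J 𝔮 R
  (IsLocalization.algEquiv (𝔮.map (Ideal.Quotient.mk J)).primeCompl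
    (Localization.AtPrime (𝔮.map (Ideal.Quotient.mk J)))
    (Localization.AtPrime 𝔮 ⧸ J.map (algebraMap S (Localization.AtPrime 𝔮)))).restrictScalars R

/-- **`S/J` is smooth over `R` at `𝔮/J` iff `S_𝔮/JS_𝔮` is formally smooth over `R`.** [folklore] -/
theorem isSmoothAt_map_mk_iff (R : Type u) [CommRing R] [Algebra R S] (hJ𝔮 : J ≤ 𝔮) :
    Algebra.IsSmoothAt R (𝔮.map (Ideal.Quotient.mk J)) ↔
      Algebra.FormallySmooth R
        (Localization.AtPrime 𝔮 ⧸ J.map (algebraMap S (Localization.AtPrime 𝔮))) :=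
  Algebra.FormallySmooth.iff_of_equiv (localizationQuotientEquiv J 𝔮 R hJ𝔮)

/-- **`S_𝔮/JS_𝔮` is formally smooth over `R` if `S/J` is smooth over `R` at `𝔮/J`.** [folklore] -/
theorem formallySmooth_localization_quotient (R : Type u) [CommRing R] [Algebra R S]
    (hJ𝔮 : J ≤ 𝔮) (hT : Algebra.IsSmoothAt R (𝔮.map (Ideal.Quotient.mk J))) :
    Algebra.FormallySmooth R
      (Localization.AtPrime 𝔮 ⧸ J.map (algebraMap S (Localization.AtPrime 𝔮))) :=
  (isSmoothAt_map_mk_iff J 𝔮 R hJ𝔮).mp hT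

end QuotientLocalization

/-! ### The localized criterion -/

section Main

variable (R : Type u) [CommRing R] (S : Type u) [CommRing S] [Algebra R S] (J : Ideal S)
  (𝔮 : Ideal S) [𝔮.IsPrime] [h𝔮J : (𝔮.map (Ideal.Quotient.mk J)).IsPrime]
  (L : Type u) [Field L] [Algebra S L] [Algebra (S ⧸ J) L] [IsScalarTower S (S ⧸ J) L]

/-- **The conormal criterion at a prime** (GW II Thm. 18.74 (iii)⇒(i), étale case, with
Prop. 18.76; the form used in BLR Lemma 3.3/1 ⟹). Let `S` be formally smooth over `R`, `J ⊆ 𝔮`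
a finitely generated ideal and a prime with `S/J` smooth over `R` at `𝔮/J`, and `L` a field
which is an `S/J`-algebra with `ker (S → L) = 𝔮`. If the fibre map of the differentials
`L ⊗_S Ω[S⁄R] → L ⊗_{S/J} Ω[(S/J)⁄R]` is injective, then `J S_𝔮 = 0`: the closed subscheme
`Spec S/J ⊆ Spec S` coincides with `Spec S` near `𝔮`.
[cite: GortzWedhorn2023, Thm. 18.74 and Prop. 18.76 (PDF pp. 106–107)] -/
theorem map_eq_bot_of_isSmoothAt_of_injective [Algebra.FormallySmooth R S] (hJ : J.FG)
    (hJ𝔮 : J ≤ 𝔮) (hT : Algebra.IsSmoothAt R (𝔮.map (Ideal.Quotient.mk J)))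
    (hker : RingHom.ker (algebraMap S L) = 𝔮)
    (hinj : Function.Injective (fibreMap R S (S ⧸ J) L)) :
    J.map (algebraMap S (Localization.AtPrime 𝔮)) = ⊥ := by
  -- notation
  set S' := Localization.AtPrime 𝔮 with hS'
  set J' : Ideal S' := J.map (algebraMap S S') with hJ'
  -- the point extends to `S'` and to `S'/J'`
  have h𝔮u : ∀ y : 𝔮.primeCompl, IsUnit (algebraMap S L y) := fun y => by
    rw [isUnit_iff_ne_zero]
    intro h0
    have hy : (y : S) ∈ RingHom.ker (algebraMap S L) := h0
    rw [hker] at hy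
    exact y.2 hy
  letI algS'L : Algebra S' L := (IsLocalization.lift (M := 𝔮.primeCompl) h𝔮u).toAlgebra
  have hS'L : ∀ s : S, algebraMap S' L (algebraMap S S' s) = algebraMap S L s := fun s =>
    IsLocalization.lift_eq (M := 𝔮.primeCompl) h𝔮u s
  haveI : IsScalarTower S S' L :=
    IsScalarTower.of_algebraMap_eq (R := S) (S := S') (A := L) fun s => (hS'L s).symm
  have hJ'0 : ∀ a ∈ J', algebraMap S' L a = 0 := by
    intro a ha
    have : J' ≤ Ideal.comap (algebraMap S' L) ⊥ := by
      rw [hJ', Ideal.map_le_iff_le_comap, Ideal.comap_comap]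
      intro j hj
      rw [Ideal.mem_comap, Ideal.mem_bot, ← IsScalarTower.algebraMap_eq, ← RingHom.mem_ker, hker]
      exact hJ𝔮 hj
    simpa using this ha
  letI algT'L : Algebra (S' ⧸ J') L := (Ideal.Quotient.lift J' (algebraMap S' L) hJ'0).toAlgebra
  have hT'L : ∀ b : S', algebraMap (S' ⧸ J') L (Ideal.Quotient.mk J' b) = algebraMap S' L b :=
    fun b => rfl
  haveI : IsScalarTower S' (S' ⧸ J') L :=
    IsScalarTower.of_algebraMap_eq (R := S') (S := S' ⧸ J') (A := L) fun b => (hT'L b).symm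
  have hSTL : ∀ s : S, algebraMap (S' ⧸ J') L (algebraMap S (S' ⧸ J') s) = algebraMap S L s :=
    fun s => by
      rw [IsScalarTower.algebraMap_apply S S' (S' ⧸ J') s,
        ← IsScalarTower.algebraMap_apply S' (S' ⧸ J') L, hS'L]
  haveI : IsScalarTower S (S' ⧸ J') L :=
    IsScalarTower.of_algebraMap_eq (R := S) (S := S' ⧸ J') (A := L) fun s => (hSTL s).symm
  haveI : IsScalarTower R (S ⧸ J) (S' ⧸ J') := isScalarTower_quotient_localization J 𝔮 R
  haveI : IsScalarTower S (S ⧸ J) (S' ⧸ J') :=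
    IsScalarTower.of_algebraMap_eq (R := S) (S := S ⧸ J) (A := S' ⧸ J') fun s => rfl
  haveI : IsScalarTower (S ⧸ J) (S' ⧸ J') L := by
    refine IsScalarTower.of_algebraMap_eq (R := S ⧸ J) (S := S' ⧸ J') (A := L) fun x => ?_
    obtain ⟨s, rfl⟩ := Ideal.Quotient.mk_surjective x
    change algebraMap (S ⧸ J) L (algebraMap S (S ⧸ J) s) =
      algebraMap (S' ⧸ J') L (algebraMap (S ⧸ J) (S' ⧸ J') (algebraMap S (S ⧸ J) s))
    rw [← IsScalarTower.algebraMap_apply S (S ⧸ J) L,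
      ← IsScalarTower.algebraMap_apply S (S ⧸ J) (S' ⧸ J'), hSTL]
  haveI := isLocalization_atPrime_quotient J 𝔮 hJ𝔮
  -- transfer of the injectivity to the localized pair
  have hinj' : Function.Injective (fibreMap R S' (S' ⧸ J') L) :=
    (injective_fibreMap_iff_of_isLocalization R S (S ⧸ J) S' (S' ⧸ J') L 𝔮.primeCompl
      (𝔮.map (Ideal.Quotient.mk J)).primeCompl).mp hinj
  have hinj'' : Function.Injective ((KaehlerDifferential.map R R S' (S' ⧸ J')).baseChange L) :=
    (injective_fibreMap_quotient_iff R S' L J').mp hinj'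
  -- hypotheses of the local criterion
  haveI : Algebra.FormallySmooth R (S' ⧸ J') := formallySmooth_localization_quotient J 𝔮 R hJ𝔮 hT
  have hJ'fg : J'.FG := hJ.map _
  have hJ'top : J' ≠ ⊤ := by
    rw [hJ', IsLocalization.map_algebraMap_ne_top_iff_disjoint 𝔮.primeCompl]
    exact Set.disjoint_left.mpr fun s hs hsJ => hs (hJ𝔮 hsJ)
  haveI : IsLocalHom (algebraMap (S' ⧸ J') L) := by
    refine ⟨fun a ha => ?_⟩
    by_contra hna
    obtain ⟨b, rfl⟩ := Ideal.Quotient.mk_surjective a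
    have hb : ¬IsUnit b := fun hb => hna (hb.map _)
    have hbm : b ∈ IsLocalRing.maximalIdeal S' := hb
    rw [← Localization.AtPrime.map_eq_maximalIdeal] at hbm
    have hb0 : algebraMap S' L b = 0 := by
      have hle : (𝔮.map (algebraMap S S')).map (algebraMap S' L) = ⊥ := by
        rw [Ideal.map_map, ← IsScalarTower.algebraMap_eq, Ideal.map_eq_bot_iff_le_ker, hker]
      have := Ideal.mem_map_of_mem (algebraMap S' L) hbm
      rwa [hle, Ideal.mem_bot] at this
    rw [hT'L, hb0] at ha
    exact not_isUnit_zero ha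
  exact eq_bot_of_formallySmooth_of_injective_map R S' J' hJ'fg hJ'top L hinj''

end Main

end Literature.AlgebraicGeometry.Smoothening

end
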